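import Mathlib
import HarnessLib

/-!
# Negative knowledge for the crux `InertialRecession` (item stmt-FinalStateConjecture-10166), III:
CESÀRO VELOCITIES FROM RATE-FREE BALANCE AT CLEAN SCALES — the two-body toy, and its sharpness

Refuter file (D-0016 negative lane, `--supports stmt-FinalStateConjecture-10166`). No Theses decl is
asserted. Companion of `KinematicShadow.lean` (p73795) and `CesaroShadow.lean`.

What the typed conclusion of the crux needs per hole is a Cesàro velocity `ξᵢ(t)/t → Vᵢ` (card
`cesaro-velocities-suffice`); what the typed antecedent offers, through the cone weight
`(1 + d^{7/4})` on `|∂^m h|` inside `|x̲| ≤ κ t`, is a momentum balance on every CLEAN sphere (one at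
distance `≍ d` from all centres) with flux `O((ε d^{-7/4})² d²) = O(ε² d^{-3/2})` — a force law of
size `K d^{-p}`, `p = 3/2`, with NO sign, NO potential and NO rate (`ε → 0` arbitrarily slowly, so
`K := sup ε²` is all one may use). The honest toy question is therefore:

  two world-lines with bounded speeds whose RELATIVE acceleration is bounded by `K · (distance)^{-p}`
  and nothing else — does the relative position divided by `t` converge?

* `tendsto_div_of_abs_deriv2_le_rpow` (**yes for `p > 1`**, scalar form; the mechanism): if
  `|s''| ≤ K |s|^{-p}` wherever `s ≠ 0` and `|s'| ≤ v`, then `s(t)/t` converges. Proof = the CROSSING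
  LEMMA `no_crossing_of_abs_deriv2_le`: between an up-crossing of the level `β t` and the next
  down-crossing of `α t` (`0 < α < β`) the trajectory stays in `{s ≥ α t}`, where the force is
  `≤ K (α t)^{-p}`, integrable; so the velocity cannot drop from `≥ β` to `≤ α` late. No integrable
  force along the trajectory, no energy, no monotonicity is used — only the bound AT LARGE SEPARATION,
  which is what clean spheres give. (Vector form for two bodies: apply it to each coordinate of
  `ξ₁ - ξ₂`, since `|wₖ| ≤ ‖w‖`; then `N = 2` Cesàro velocities follow from the convergence of the
  total momentum at scale `t` — `Disproof.lean` §H.)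
* sharpness (**no for `p = 1`**) is in the companion file `CleanScaleSharpness.lean`
  (`not_tendsto_div_at_exponent_one`: `s(t) = t (2 + sin (log (log t)))` has `|s''| ≤ 9 |s|^{-1}`,
  `|s'| ≤ 4`, and `s(t)/t` does not converge). In crux units `p = 2w - 2` for a cone weight `d^w`: the
  typed `w = 7/4` gives `p = 3/2`, and the toy breaks exactly at `w = 3/2` — the margin `7/4 > 3/2` is
  load-bearing even for Cesàro velocities (`cesaro_exponent_window`).

These are the rate-free replacement, for the conclusion AS TYPED, of the integrable-force mechanism
`tendsto_of_integrableOn_deriv` of `KinematicShadow.lean` (which the hypothesis cannot feed at parabolic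
separation, `quadraticRemainder_not_integrable` in `Disproof.lean` §D).
-/

set_option linter.dupNamespace false

noncomputable section

namespace Summit.FinalStateConjecture.FinalStateConjecture.Theorems.InertialRecession.Negative

open Filter Set
open scoped Topology

/-! ## One-sided derivative signs at first hitting times -/

/-- If `h < 0` on `[a, b)` and `h b ≥ 0` then `h' b ≥ 0`. [folklore] -/
lemma deriv_nonneg_of_neg_on_Ico {h : ℝ → ℝ} {h' a b : ℝ} (hab : a < b) (hd : HasDerivAt h h' b)
    (hneg : ∀ t ∈ Ico a b, h t < 0) (hb : 0 ≤ h b) : 0 ≤ h' := by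
  have ht : Tendsto (slope h b) (𝓝[<] b) (𝓝 h') :=
    (hasDerivAt_iff_tendsto_slope.mp hd).mono_left (nhdsLT_le_nhdsNE b)
  refine ge_of_tendsto ht ?_
  filter_upwards [Ico_mem_nhdsLT hab] with t ht
  rw [slope_def_field]
  have h1 : h t - h b < 0 := by linarith [hneg t ht]
  have h2 : t - b < 0 := by linarith [ht.2]
  exact (div_pos_of_neg_of_neg h1 h2).le

/-- If `0 < h` on `[a, b)` and `h b ≤ 0` then `h' b ≤ 0`. [folklore] -/
lemma deriv_nonpos_of_pos_on_Ico {h : ℝ → ℝ} {h' a b : ℝ} (hab : a < b) (hd : HasDerivAt h h' b)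
    (hpos : ∀ t ∈ Ico a b, 0 < h t) (hb : h b ≤ 0) : h' ≤ 0 := by
  have := deriv_nonneg_of_neg_on_Ico hab hd.neg (fun t ht ↦ by simpa using hpos t ht)
    (by simpa using hb)
  linarith

/-- First hitting time of a closed condition on `[a, b]`: if `P` fails at `a` and holds at `b`, there is
a first `c ∈ (a, b]` where it holds. [folklore] -/
lemma exists_first_hit {P : ℝ → Prop} {a b : ℝ} (hab : a ≤ b)
    (hP : IsClosed {t | t ∈ Icc a b ∧ P t}) (ha : ¬ P a) (hb : P b) :
    ∃ c, a < c ∧ c ≤ b ∧ P c ∧ ∀ t ∈ Ico a c, ¬ P t := by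
  set A := {t | t ∈ Icc a b ∧ P t} with hA
  have hne : A.Nonempty := ⟨b, ⟨⟨hab, le_rfl⟩, hb⟩⟩
  have hbdd : BddBelow A := ⟨a, fun t ht ↦ ht.1.1⟩
  have hmem : sInf A ∈ A := hP.csInf_mem hne hbdd
  refine ⟨sInf A, ?_, hmem.1.2, hmem.2, fun t ht hPt ↦ ?_⟩
  · rcases eq_or_lt_of_le hmem.1.1 with h | h
    · exact absurd (h ▸ hmem.2) ha
    · exact h
  · have : sInf A ≤ t := csInf_le hbdd ⟨⟨ht.1, ht.2.le.trans hmem.1.2⟩, hPt⟩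
    linarith [ht.2]

/-! ## The crossing lemma and Cesàro convergence for `p > 1` -/

/-- **Crossing lemma.** On `[t₀, ∞)` let `s` be twice differentiable with `|s''| ≤ K t^{-p}`
(`p > 1`) WHEREVER `s ≥ α t` (`α > 0`). Then `s(t)/t` cannot be frequently below `α` and frequently
above `β > α`: between a first up-crossing of `β t` (where `s' ≥ β`) and the next down-crossing of
`α t` (where `s' ≤ α`) the trajectory stays in the controlled region, in which `s' - (K/(p-1)) t^{1-p}`
is monotone, so the velocity drops by at most `(K/(p-1)) t^{1-p} → 0`. [folklore] -/
theorem no_crossing_of_abs_deriv2_le {s s' s'' : ℝ → ℝ} {t₀ α β K p : ℝ} (ht₀ : 0 < t₀)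
    (hαβ : α < β) (hp : 1 < p) (hK : 0 ≤ K)
    (hs : ∀ t, t₀ ≤ t → HasDerivAt s (s' t) t) (hs' : ∀ t, t₀ ≤ t → HasDerivAt s' (s'' t) t)
    (hbound : ∀ t, t₀ ≤ t → α * t ≤ s t → |s'' t| ≤ K * t ^ (-p))
    (hlo : ∃ᶠ t in atTop, s t < α * t) (hhi : ∃ᶠ t in atTop, β * t < s t) : False := by
  set c := K / (p - 1) with hc
  have hc0 : 0 ≤ c := div_nonneg hK (by linarith)
  -- late enough that the velocity drop `c t^{1-p}` is below `β - α`
  have hev : ∀ᶠ t in atTop, t₀ ≤ t ∧ c * t ^ (1 - p) < β - α := by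
    refine (eventually_ge_atTop t₀).and ?_
    have h1 : Tendsto (fun t : ℝ ↦ c * t ^ (1 - p)) atTop (𝓝 (c * 0)) :=
      (tendsto_rpow_neg_atTop (by linarith : 0 < p - 1)).const_mul c |>.congr'
        (by filter_upwards with t; congr 1; ring_nf)
    rw [mul_zero] at h1
    exact h1.eventually (gt_mem_nhds (by linarith))
  obtain ⟨ta, hsa, hta0, hta⟩ := (hlo.and_eventually hev).exists
  obtain ⟨tb, hsb, htab⟩ := (hhi.and_eventually (eventually_gt_atTop ta)).exists
  obtain ⟨td, hsd, htbd⟩ := (hlo.and_eventually (eventually_gt_atTop tb)).exists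
  have hta_pos : 0 < ta := lt_of_lt_of_le ht₀ hta0
  -- continuity of `s` and `s'` after `t₀`
  have hscont : ∀ a b, t₀ ≤ a → ContinuousOn s (Icc a b) := fun a b ha t ht ↦
    (hs t (ha.trans ht.1)).continuousAt.continuousWithinAt
  have hclosed : ∀ (a b μ : ℝ) (σ : ℝ), t₀ ≤ a →
      IsClosed {t | t ∈ Icc a b ∧ σ * (s t - μ * t) ≤ 0} := fun a b μ σ ha ↦ by
    have hcts : ContinuousOn (fun t ↦ σ * (s t - μ * t)) (Icc a b) :=
      continuousOn_const.mul ((hscont a b ha).sub (continuousOn_const.mul continuousOn_id))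
    have := hcts.preimage_isClosed_of_isClosed isClosed_Icc (isClosed_Iic (a := (0 : ℝ)))
    convert this using 1
    ext t
    simp
  -- first up-crossing `tu ∈ (ta, tb]` of the level `β t`
  obtain ⟨tu, htau, htub, hsu, hbefore_u⟩ := exists_first_hit (P := fun t ↦ (-1) * (s t - β * t) ≤ 0)
    htab.le (hclosed ta tb β (-1) hta0) (by nlinarith) (by nlinarith)
  have hsu' : β * tu ≤ s tu := by nlinarith
  have htu0 : t₀ ≤ tu := hta0.trans htau.le
  have htu_pos : 0 < tu := lt_of_lt_of_le hta_pos htau.le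
  -- first down-crossing `tc ∈ (tu, td]` of the level `α t`
  have htud : tu < td := lt_of_le_of_lt htub htbd
  obtain ⟨tc, htuc, htcd, hsc, hbefore_c⟩ := exists_first_hit (P := fun t ↦ (1 : ℝ) * (s t - α * t) ≤ 0)
    htud.le (hclosed tu td α 1 htu0) (by nlinarith) (by nlinarith)
  have hsc' : s tc ≤ α * tc := by nlinarith
  have htc0 : t₀ ≤ tc := htu0.trans htuc.le
  -- derivative signs at the two hitting times
  have hderiv_u : β ≤ s' tu := by
    have hd : HasDerivAt (fun t ↦ s t - β * t) (s' tu - β * 1) tu :=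
      (hs tu htu0).sub ((hasDerivAt_id tu).const_mul β)
    have := deriv_nonneg_of_neg_on_Ico htau hd
      (fun t ht ↦ by have := hbefore_u t ht; push Not at this; nlinarith) (by nlinarith)
    linarith
  have hderiv_c : s' tc ≤ α := by
    have hd : HasDerivAt (fun t ↦ s t - α * t) (s' tc - α * 1) tc :=
      (hs tc htc0).sub ((hasDerivAt_id tc).const_mul α)
    have := deriv_nonpos_of_pos_on_Ico htuc hd
      (fun t ht ↦ by have := hbefore_c t ht; push Not at this; nlinarith) (by linarith)
    linarith
  -- on `(tu, tc)` the trajectory is in the controlled region `s > α t`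
  have hregion : ∀ t ∈ Ioo tu tc, α * t < s t := fun t ht ↦ by
    have := hbefore_c t ⟨ht.1.le, ht.2⟩; push Not at this; nlinarith
  -- `Ψ t := s' t - c t^{1-p}` is monotone on `[tu, tc]`
  have hΓ : ∀ t, 0 < t → HasDerivAt (fun t : ℝ ↦ c * t ^ (1 - p)) (-(K * t ^ (-p))) t := by
    intro t ht
    have h1 := (Real.hasDerivAt_rpow_const (p := 1 - p) (Or.inl ht.ne')).const_mul c
    refine h1.congr_deriv ?_
    rw [show (1 - p - 1 : ℝ) = -p by ring, hc]
    have hp1 : p - 1 ≠ 0 := by linarith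
    field_simp
    ring
  have hmono : MonotoneOn (fun t ↦ s' t - c * t ^ (1 - p)) (Icc tu tc) := by
    refine monotoneOn_of_hasDerivWithinAt_nonneg (convex_Icc tu tc) ?_ ?_ ?_ (f' := fun t ↦
      s'' t + K * t ^ (-p))
    · intro t ht
      exact ((hs' t (htu0.trans ht.1)).sub (hΓ t (lt_of_lt_of_le htu_pos ht.1))).continuousAt
        |>.continuousWithinAt
    · intro t ht
      rw [interior_Icc] at ht
      exact (((hs' t (htu0.trans ht.1.le)).sub (hΓ t (lt_trans htu_pos ht.1))).congr_deriv
        (by ring)).hasDerivWithinAt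
    · intro t ht
      rw [interior_Icc] at ht
      have hb := hbound t (htu0.trans ht.1.le) (hregion t ht).le
      linarith [neg_abs_le (s'' t)]
  have hkey := hmono (left_mem_Icc.mpr htuc.le) (right_mem_Icc.mpr htuc.le) htuc.le
  simp only at hkey
  -- `c tc^{1-p} ≥ 0` and `c tu^{1-p} ≤ c ta^{1-p} < β - α`
  have h1 : 0 ≤ c * tc ^ (1 - p) := mul_nonneg hc0 (Real.rpow_nonneg (by linarith) _)
  have h2 : c * tu ^ (1 - p) ≤ c * ta ^ (1 - p) :=
    mul_le_mul_of_nonneg_left (Real.rpow_le_rpow_of_nonpos hta_pos htau.le (by linarith)) hc0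
  linarith


/-- **Cesàro convergence from a force bound at large separation only** (`p > 1`). If
`|s''| ≤ K |s|^{-p}` wherever `s ≠ 0` on `[t₀, ∞)` and `|s'| ≤ v`, then `s(t)/t` converges.
(No integrability of `s''` along the trajectory is assumed or implied.) [folklore] -/
theorem tendsto_div_of_abs_deriv2_le_rpow {s s' s'' : ℝ → ℝ} {t₀ K p v : ℝ} (ht₀ : 0 < t₀)
    (hp : 1 < p) (hK : 0 ≤ K)
    (hs : ∀ t, t₀ ≤ t → HasDerivAt s (s' t) t) (hs' : ∀ t, t₀ ≤ t → HasDerivAt s' (s'' t) t)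
    (hv : ∀ t, t₀ ≤ t → |s' t| ≤ v)
    (hbound : ∀ t, t₀ ≤ t → s t ≠ 0 → |s'' t| ≤ K * |s t| ^ (-p)) :
    ∃ L, Tendsto (fun t ↦ s t / t) atTop (𝓝 L) := by
  -- Step 1: no band `[α, β]` with `0 < α` is crossed infinitely often by `σ s / t`, `σ = ± 1`
  have cross : ∀ σ : ℝ, (σ = 1 ∨ σ = -1) → ∀ α β : ℝ, 0 < α → α < β →
      (∃ᶠ t in atTop, σ * s t < α * t) → (∃ᶠ t in atTop, β * t < σ * s t) → False := by
    intro σ hσ α β hα hαβ hlo hhi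
    have hσabs : |σ| = 1 := by rcases hσ with h | h <;> simp [h]
    refine no_crossing_of_abs_deriv2_le (s := fun t ↦ σ * s t) (s' := fun t ↦ σ * s' t)
      (s'' := fun t ↦ σ * s'' t) (K := K * α ^ (-p)) ht₀ hαβ hp (by positivity)
      (fun t ht ↦ (hs t ht).const_mul σ) (fun t ht ↦ (hs' t ht).const_mul σ) ?_ hlo hhi
    intro t ht hst
    have ht' : 0 < t := lt_of_lt_of_le ht₀ ht
    have hpos : 0 < σ * s t := lt_of_lt_of_le (by positivity) hst
    have hne : s t ≠ 0 := by
      rintro h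
      rw [h, mul_zero] at hpos
      exact lt_irrefl _ hpos
    have h1 := hbound t ht hne
    rw [abs_mul, hσabs, one_mul]
    have habs : |s t| = σ * s t := by
      rcases hσ with h | h
      · subst h
        rw [one_mul] at hpos ⊢
        exact abs_of_pos hpos
      · subst h
        have : s t < 0 := by linarith
        rw [abs_of_neg this]
        ring
    rw [habs] at h1
    calc |s'' t| ≤ K * (σ * s t) ^ (-p) := h1
      _ ≤ K * (α * t) ^ (-p) := mul_le_mul_of_nonneg_left
          (Real.rpow_le_rpow_of_nonpos (by positivity) hst (by linarith)) hK
      _ = K * α ^ (-p) * t ^ (-p) := by rw [Real.mul_rpow hα.le ht'.le]; ring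
  -- Step 2: `f t := s t / t` is bounded after `t₀`
  set f : ℝ → ℝ := fun t ↦ s t / t with hf
  set B := |s t₀| / t₀ + |v| with hB
  have hbd : ∀ t, t₀ ≤ t → |f t| ≤ B := by
    intro t ht
    have ht' : 0 < t := lt_of_lt_of_le ht₀ ht
    have hmv : ‖s t - s t₀‖ ≤ |v| * (t - t₀) := by
      refine norm_image_sub_le_of_norm_deriv_le_segment' (f := s) (f' := s')
        (fun x hx ↦ (hs x hx.1).hasDerivWithinAt) (fun x hx ↦ ?_) t (right_mem_Icc.mpr ht)
      rw [Real.norm_eq_abs]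
      exact (hv x hx.1).trans (le_abs_self v)
    rw [Real.norm_eq_abs] at hmv
    simp only [hf, hB]
    rw [abs_div, abs_of_pos ht', div_le_iff₀ ht']
    have h1 : |s t| ≤ |s t₀| + |v| * (t - t₀) := by
      have := abs_sub_abs_le_abs_sub (s t) (s t₀)
      linarith
    have h2 : |s t₀| ≤ |s t₀| / t₀ * t := by
      rw [div_mul_eq_mul_div, le_div_iff₀ ht₀]
      exact mul_le_mul_of_nonneg_left ht (abs_nonneg _)
    nlinarith [abs_nonneg v, abs_nonneg (s t₀)]
  -- Step 3: a cluster point `c` of `f` (Bolzano–Weierstrass on `f (t₀ + n)`)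
  obtain ⟨c, -, φ, hφ, hcφ⟩ := tendsto_subseq_of_bounded (Metric.isBounded_Icc (-B) B)
    (x := fun n : ℕ ↦ f (t₀ + n)) (fun n ↦ by
      have := hbd (t₀ + n) (by simp)
      rw [abs_le] at this
      exact ⟨this.1, this.2⟩)
  have hseq : Tendsto (fun n : ℕ ↦ t₀ + (φ n : ℝ)) atTop atTop :=
    tendsto_atTop_add_const_left _ _ (tendsto_natCast_atTop_atTop.comp hφ.tendsto_atTop)
  have hcluster : ∀ δ > 0, ∃ᶠ t in atTop, |f t - c| < δ := fun δ hδ ↦ by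
    have hev : ∀ᶠ n in atTop, |f (t₀ + φ n) - c| < δ := by
      have := (Metric.tendsto_nhds.mp hcφ) δ hδ
      simpa [Real.dist_eq, Function.comp] using this
    exact hseq.frequently hev.frequently
  -- Step 4: if `f` does not tend to `c`, some band free of `0` is crossed infinitely often
  refine ⟨c, ?_⟩
  by_contra hnot
  obtain ⟨ε, hε, hfreq⟩ : ∃ ε > 0, ∃ᶠ t in atTop, ε ≤ |f t - c| := by
    rw [Metric.tendsto_nhds] at hnot
    push Not at hnot
    obtain ⟨ε, hε, h⟩ := hnot
    refine ⟨ε, hε, ?_⟩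
    simpa [Filter.not_eventually, not_lt, Real.dist_eq] using h
  have hsplit : (∃ᶠ t in atTop, c + ε ≤ f t) ∨ ∃ᶠ t in atTop, f t ≤ c - ε := by
    rw [← frequently_or_distrib]
    refine hfreq.mono fun t ht ↦ ?_
    rcases le_abs'.mp ht with h | h
    · right; linarith
    · left; linarith
  have hft : ∀ {t μ : ℝ}, 0 < t → (f t < μ ↔ s t < μ * t) := fun {t μ} ht ↦ by
    simp only [hf]
    rw [div_lt_iff₀ ht]
  have hft' : ∀ {t μ : ℝ}, 0 < t → (μ < f t ↔ μ * t < s t) := fun {t μ} ht ↦ by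
    simp only [hf]
    rw [lt_div_iff₀ ht]
  rcases hsplit with hup | hdown
  · by_cases hc0 : 0 < c + ε / 2
    · -- positive band `(c + ε/2, c + 3ε/4)` for `s`
      refine cross 1 (Or.inl rfl) (c + ε / 2) (c + 3 * ε / 4) hc0 (by linarith) ?_ ?_
      · refine ((hcluster (ε / 2) (by positivity)).and_eventually (eventually_gt_atTop 0)).mono ?_
        rintro t ⟨ht, ht0⟩
        have : s t < (c + ε / 2) * t := (hft ht0).mp (by have := (abs_lt.mp ht).2; linarith)
        linarith
      · refine (hup.and_eventually (eventually_gt_atTop 0)).mono ?_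
        rintro t ⟨ht, ht0⟩
        have : (c + 3 * ε / 4) * t < s t := (hft' ht0).mp (by linarith)
        linarith
    · -- negative band for `-s`: levels `-(c + 3ε/8) < -(c + ε/4)`, both positive
      push Not at hc0
      refine cross (-1) (Or.inr rfl) (-(c + 3 * ε / 8)) (-(c + ε / 4)) (by linarith) (by linarith)
        ?_ ?_
      · refine (hup.and_eventually (eventually_gt_atTop 0)).mono ?_
        rintro t ⟨ht, ht0⟩
        have : (c + 3 * ε / 8) * t < s t := (hft' ht0).mp (by linarith)
        linarith
      · refine ((hcluster (ε / 4) (by positivity)).and_eventually (eventually_gt_atTop 0)).mono ?_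
        rintro t ⟨ht, ht0⟩
        have : s t < (c + ε / 4) * t := (hft ht0).mp (by have := (abs_lt.mp ht).2; linarith)
        linarith
  · by_cases hc0 : c - ε / 2 < 0
    · -- positive band for `-s`: levels `-c + ε/2 < -c + 3ε/4`
      refine cross (-1) (Or.inr rfl) (-c + ε / 2) (-c + 3 * ε / 4) (by linarith) (by linarith)
        ?_ ?_
      · refine ((hcluster (ε / 2) (by positivity)).and_eventually (eventually_gt_atTop 0)).mono ?_
        rintro t ⟨ht, ht0⟩
        have : (c - ε / 2) * t < s t := (hft' ht0).mp (by have := (abs_lt.mp ht).1; linarith)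
        linarith
      · refine (hdown.and_eventually (eventually_gt_atTop 0)).mono ?_
        rintro t ⟨ht, ht0⟩
        have : s t < (c - 3 * ε / 4) * t := (hft ht0).mp (by linarith)
        linarith
    · -- positive band `(c - 3ε/8, c - ε/4)` for `s`
      push Not at hc0
      refine cross 1 (Or.inl rfl) (c - 3 * ε / 8) (c - ε / 4) (by linarith) (by linarith) ?_ ?_
      · refine (hdown.and_eventually (eventually_gt_atTop 0)).mono ?_
        rintro t ⟨ht, ht0⟩
        have : s t < (c - 3 * ε / 8) * t := (hft ht0).mp (by linarith)
        linarith
      · refine ((hcluster (ε / 4) (by positivity)).and_eventually (eventually_gt_atTop 0)).mono ?_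
        rintro t ⟨ht, ht0⟩
        have : (c - ε / 4) * t < s t := (hft' ht0).mp (by have := (abs_lt.mp ht).1; linarith)
        linarith

/-- In crux units: a cone weight `d^w` on `|∂h|` gives clean-sphere fluxes `ε² d^{2 - 2w}`, i.e. the
toy exponent `p = 2w - 2`; the mechanism above needs `p > 1`, i.e. exactly `w > 3/2` (the typed crux has
`w = 7/4`). [folklore] -/
theorem cesaro_exponent_window (w : ℝ) : 1 < 2 * w - 2 ↔ 3 / 2 < w := by
  constructor <;> intro h <;> linarith

end Summit.FinalStateConjecture.FinalStateConjecture.Theorems.InertialRecession.Negative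

end
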